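import Summits.AtomisticToContinuum.FouriersLaw.Theorems.PhononMeanFreePathDefs
import Summits.AtomisticToContinuum.FouriersLaw.Theorems.OddSectorIrreversibilityWitnessGlueReflection
import Summits.AtomisticToContinuum.FouriersLaw.Theorems.JunctionLocalityNonBallisticProfileUniformBound

/-!
# Left–right reflection of the mean forecast (line `two-horizons-forecast-loss`, crux `IncoherentChannel`)

Helper file of line `two-horizons-forecast-loss` of crux `PhononMeanFreePath.IncoherentChannel`
(stmt-AtomisticToContinuum-11811), stub group "Reflection".

Setting: `P = pinnedChain ω₂ lam β γ` (`ω₂ > 0`, `lam, β, γ ≥ 0`), the `(N+1)`-site chain `0..N` with BOTH baths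
at the same temperature `T` (any real `T`), `μ₀ = P.gibbsMeasure (N+1) T`, `K_t = P.transitionKernel (N+1) T T t⁺`,
the mean forecast of the far momentum `v_t = fcast … N t = K_t p_N` and its norm
`S_N(t) = fnorm … N t = ‖v_t‖²_{L²(μ₀)}` (`Theorems/PhononMeanFreePathDefs`).

The LEFT–RIGHT REFLECTION STRUCTURE of the forecast. The site reflection `R = siteReflection (N+1) : (q,p) ↦
(q∘rev, p∘rev)` satisfies, at equal bath temperatures, `K_t(R z, ·) = R_* K_t(z, ·)`
(`OddSectorWitness.transitionKernel_siteReflection`, swap invariance of the product Wiener measure) and preserves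
the Gibbs law `μ₀` (`NonBallistic.measurePreserving_siteReflection_gibbsMeasure`, the FPU interaction is even,
`pinnedChain_V_neg`). Hence:

* `reflection_leftForecast_siteReflection` — pointwise `(K_t p_0)(R z) = (K_t p_N)(z) = v_t(z)`
  (`p_0 ∘ R = p_N`, change of variables under `R`, no integrability needed), and the mirror form
  `reflection_fcast_siteReflection` — `v_t(R z) = (K_t p_0)(z)`;
* `leftForecastNorm_eq_fnorm` (registered stub) — `‖K_t p_0‖²_{L²(μ₀)} = ‖K_t p_N‖²_{L²(μ₀)} = S_N(t)`
  (`R` preserves `μ₀`; again no integrability needed).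
-/

noncomputable section

namespace Summit.AtomisticToContinuum.FouriersLaw.Theorems.PhononMeanFreePath

open MeasureTheory Set Filter Topology
open scoped NNReal
open Literature.MathematicalPhysics.KineticTheory.HeatConduction
open Summit.AtomisticToContinuum.FouriersLaw.Theorems.OddSectorWitness (transitionKernel_siteReflection)
open Summit.AtomisticToContinuum.FouriersLaw.Theorems.NonBallistic (measurePreserving_siteReflection_gibbsMeasure)

section Setting

variable {ω₂ lam β γ : ℝ} (hω : 0 < ω₂) (hl : 0 ≤ lam) (hβ : 0 ≤ β) (hγ : 0 ≤ γ)
include hω hl hβ hγ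

/-- **The left forecast is the reflected right forecast**, pointwise: for the pinned chain with both baths at the
same temperature `T`, every `N`, every real `t` and every microstate `z`,
`(K_t p_0)(R z) = ∫ p_0 dK_t(R z, ·) = ∫ (p_0 ∘ R) dK_t(z, ·) = (K_t p_N)(z) = v_t(z)`
(`K_t(R z, ·) = R_* K_t(z, ·)`, `transitionKernel_siteReflection`; `p_0 ∘ R = p_{rev 0} = p_N`; the change of
variables is along the measurable involution `siteReflectionEquiv`, so no integrability is needed). [folklore] -/
theorem reflection_leftForecast_siteReflection (T : ℝ) (N : ℕ) (t : ℝ) (z : PhaseSpace (N + 1)) :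
    ∫ y, y.2 0 ∂((pinnedChain ω₂ lam β γ).transitionKernel (N + 1) T T t.toNNReal (siteReflection (N + 1) z)) =
      fcast ω₂ lam β γ T N t z := by
  have hR : MeasurableEmbedding (siteReflection (N + 1)) := (siteReflectionEquiv (N + 1)).measurableEmbedding
  rw [transitionKernel_siteReflection hω hl hβ hγ (N + 1) T t.toNNReal z, hR.integral_map]
  simp only [siteReflection_snd, Fin.rev_zero]
  rfl

/-- **The right forecast is the reflected left forecast**, pointwise: `v_t(R z) = (K_t p_0)(z)` for every
microstate `z` (`reflection_leftForecast_siteReflection` at `R z`, `R ∘ R = id`). [folklore] -/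
theorem reflection_fcast_siteReflection (T : ℝ) (N : ℕ) (t : ℝ) (z : PhaseSpace (N + 1)) :
    fcast ω₂ lam β γ T N t (siteReflection (N + 1) z) =
      ∫ y, y.2 0 ∂((pinnedChain ω₂ lam β γ).transitionKernel (N + 1) T T t.toNNReal z) := by
  rw [← reflection_leftForecast_siteReflection hω hl hβ hγ T N t (siteReflection (N + 1) z),
    siteReflection_siteReflection]

end Setting

/-- **Reflection identity for the forecast norm (registered stub `leftForecastNorm_eq_fnorm`).** For the pinned
chain with both baths at the same temperature `T` (any `T`, `ω₂ > 0`, `lam, β, γ ≥ 0`), the left forecast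
`ṽ_t = K_t p_0` has the same `L²(μ₀)` norm as the right one: `∫ (K_t p_0)² dμ₀ = ∫ (K_t p_N)² dμ₀ = S_N(t)`.
Proof: `v_t = (K_t p_0) ∘ R` pointwise (`reflection_leftForecast_siteReflection`) and `R` preserves `μ₀`
(`measurePreserving_siteReflection_gibbsMeasure`, even interaction `pinnedChain_V_neg`), change of variables along
the measurable involution `siteReflectionEquiv` (no integrability needed). [folklore] -/
theorem leftForecastNorm_eq_fnorm : ∀ ω₂ lam β γ : ℝ, 0 < ω₂ → 0 ≤ lam → 0 ≤ β → 0 ≤ γ → ∀ (T : ℝ) (N : ℕ) (t : ℝ), ∫ z, (∫ y, y.2 0 ∂((pinnedChain ω₂ lam β γ).transitionKernel (N + 1) T T t.toNNReal z)) ^ 2 ∂((pinnedChain ω₂ lam β γ).gibbsMeasure (N + 1) T) = fnorm ω₂ lam β γ T N t := by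
  intro ω₂ lam β γ hω hl hβ hγ T N t
  have hR := measurePreserving_siteReflection_gibbsMeasure (pinnedChain ω₂ lam β γ) (pinnedChain_V_neg ω₂ lam β γ)
    (N + 1) T
  symm
  calc fnorm ω₂ lam β γ T N t
      = ∫ z, (∫ y, y.2 0 ∂((pinnedChain ω₂ lam β γ).transitionKernel (N + 1) T T t.toNNReal
          (siteReflection (N + 1) z))) ^ 2 ∂((pinnedChain ω₂ lam β γ).gibbsMeasure (N + 1) T) := by
        unfold fnorm
        refine integral_congr_ae (Eventually.of_forall fun z => ?_)
        simp only [reflection_leftForecast_siteReflection hω hl hβ hγ]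
    _ = ∫ z, (∫ y, y.2 0 ∂((pinnedChain ω₂ lam β γ).transitionKernel (N + 1) T T t.toNNReal z)) ^ 2
          ∂((pinnedChain ω₂ lam β γ).gibbsMeasure (N + 1) T) :=
        hR.integral_comp (siteReflectionEquiv (N + 1)).measurableEmbedding
          (fun z => (∫ y, y.2 0 ∂((pinnedChain ω₂ lam β γ).transitionKernel (N + 1) T T t.toNNReal z)) ^ 2)

end Summit.AtomisticToContinuum.FouriersLaw.Theorems.PhononMeanFreePath

end
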